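import Mathlib

/-!
# The dyadic blocks of negative fundamental discriminants (negative-side support for the crux
`ArithStatLadder.AvgFaceBeyondPrior`, stmt-QuantumAdvantage-2427)

Pure arithmetic about `fundBlockL(n) = {d ∈ [2^(n-1), 2^n) | −d fundamental}`, written with the
route's LITERAL predicate (so the statements below are syntactically about the route's finset; the
local notations `IsFundNegL(d)`, `fundBlockL(n)` introduce no declarations):

* `isFundNeg_iff_nat` — the `ℤ`-literal predicate agrees with a kernel-evaluable `Bool` test
  `isFundNegNat B d` (for `0 < d < B²`), whence `fundBlock_eq_natForm` and `decide`;
* `fundBlock_nonempty` — the blocks are nonempty for every `n ≥ 2` (Bertrand: `d = 8p`);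
* `three_mul_card_fundBlock_le` — for every `n ≥ 5` at most a third of the n-bit integers have
  `−d` fundamental (sieve by the residues mod `4, 16, 9, 25`, counted exactly in the dyadic block,
  for `n ≥ 11`; `decide` for `5 ≤ n ≤ 10`); true density `3/π² ≈ 0.304`.

Used by `AvgFaceBeyondPriorConditioning.lean`: on uniform n-bit integers the constant predictor
`3 ∤ h` errs on at most a third, so the crux's `δ = 1/3` face is false without the conditioning
on fundamental discriminants. (cdisprove seat, 2026-08-16.)
-/

namespace Summit.QuantumAdvantage.QuantumAdvantage.Theorems.AvgFaceBeyondPrior.Negative.Blocks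

open Finset
open scoped Classical

/-- The route's literal predicate "`−d` is a fundamental discriminant" (notation, no declaration). -/
local notation "IsFundNegL(" d ")" =>
  ((((-(d:ℤ)) % 4 = 1 ∧ Squarefree (-(d:ℤ)) ∧ (-(d:ℤ)) ≠ 1) ∨
    (4 ∣ (-(d:ℤ)) ∧ ((-(d:ℤ)) / 4 % 4 = 2 ∨ (-(d:ℤ)) / 4 % 4 = 3) ∧ Squarefree ((-(d:ℤ)) / 4))))

/-- The route's literal dyadic block of fundamental discriminants (notation, no declaration). -/
local notation "fundBlockL(" n ")" =>
  (Finset.filter (fun d : ℕ => IsFundNegL(d)) (Finset.Ico (2 ^ (n - 1)) (2 ^ n)))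


/-- Bounded squarefreeness test (kernel-evaluable `Bool`): no `k` with `2 ≤ k < B` has `k² ∣ d`. [folklore] -/
def sqfreeB (B d : ℕ) : Bool := decide (∀ k < B, 2 ≤ k → ¬ (k * k ∣ d))

/-- For `0 < d < B²`, `sqfreeB B d` tests squarefreeness. [folklore] -/
theorem squarefree_iff_sqfreeB {B d : ℕ} (hd : 0 < d) (hB : d < B * B) :
    Squarefree d ↔ sqfreeB B d = true := by
  rw [sqfreeB, decide_eq_true_iff]
  constructor
  · intro h k _ h2 hdvd
    have := Nat.isUnit_iff.1 (h k hdvd)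
    omega
  · intro h k hk
    rw [Nat.isUnit_iff]
    by_contra h1
    rcases Nat.eq_zero_or_pos k with rfl | hk0
    · simp at hk; omega
    have hkB : k < B := by
      by_contra hle
      push Not at hle
      have : B * B ≤ k * k := Nat.mul_le_mul hle hle
      have := Nat.le_of_dvd hd hk
      omega
    exact h k hkB (by omega) hk

/-- `ℕ`-arithmetic (kernel-evaluable `Bool`) form of "`−d` is a fundamental discriminant". [folklore] -/
def isFundNegNat (B d : ℕ) : Bool :=
  (d % 4 == 3 && sqfreeB B d) || ((d % 16 == 4 || d % 16 == 8) && sqfreeB B (d / 4))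

/-- The route's `ℤ`-literal predicate agrees with the `Bool` `ℕ`-form (for `0 < d < B²`). [folklore] -/
theorem isFundNeg_iff_nat {B d : ℕ} (hd : 0 < d) (hB : d < B * B) :
    IsFundNegL(d) ↔ isFundNegNat B d = true := by
  simp only [isFundNegNat, Bool.or_eq_true, Bool.and_eq_true, beq_iff_eq]
  have hsq1 : Squarefree (-(d:ℤ)) ↔ Squarefree d := by
    rw [← Int.squarefree_natAbs, Int.natAbs_neg, Int.natAbs_natCast]
  have hq : (-(d:ℤ)) / 4 = -(((d + 3) / 4 : ℕ) : ℤ) := by omega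
  have hsq2 : Squarefree ((-(d:ℤ)) / 4) ↔ Squarefree ((d + 3) / 4) := by
    rw [hq, ← Int.squarefree_natAbs, Int.natAbs_neg, Int.natAbs_natCast]
  rw [hsq1, hsq2, squarefree_iff_sqfreeB hd hB]
  constructor
  · rintro (⟨h1, h2, -⟩ | ⟨h4, h2, h3⟩)
    · exact Or.inl ⟨by omega, h2⟩
    · right
      refine ⟨by omega, ?_⟩
      rw [show (d + 3) / 4 = d / 4 by omega] at h3
      exact (squarefree_iff_sqfreeB (by omega) (by omega)).1 h3
  · rintro (⟨h1, h2⟩ | ⟨h1, h3⟩)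
    · exact Or.inl ⟨by omega, h2, by omega⟩
    · right
      refine ⟨by omega, by omega, ?_⟩
      rw [show (d + 3) / 4 = d / 4 by omega]
      exact (squarefree_iff_sqfreeB (by omega) (by omega)).2 h3

/-- The block in evaluable form: `fundBlock n = {d ∈ [2^(n-1), 2^n) | isFundNegNat (2^b) d}` when
`n ≤ 2b`. [folklore] -/
theorem fundBlock_eq_natForm (n b : ℕ) (hnb : n ≤ 2 * b) :
    fundBlockL(n) = (Ico (2 ^ (n - 1)) (2 ^ n)).filter (fun d => isFundNegNat (2 ^ b) d = true) := by
  refine Finset.filter_congr fun d hd => ?_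
  rw [mem_Ico] at hd
  have h1 : 0 < d := lt_of_lt_of_le (Nat.two_pow_pos _) hd.1
  have h2 : d < 2 ^ b * 2 ^ b := by
    rw [← pow_add]
    exact lt_of_lt_of_le hd.2 (Nat.pow_le_pow_right Nat.two_pos (by omega))
  exact isFundNeg_iff_nat h1 h2

/-- **The blocks are nonempty from `n = 2` on** (so the `pure []` branch of `U` is exactly
`n ≤ 1`): `decide` for `2 ≤ n ≤ 7`, and for `n ≥ 6` the witness `d = 8p` with a Bertrand prime
`2^(n-4) < p < 2^(n-3)` (`−8p = 4·(−2p)`, `−2p ≡ 2 (mod 4)`, `2p` squarefree). [folklore] -/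
theorem fundBlock_nonempty {n : ℕ} (hn : 2 ≤ n) : (fundBlockL(n)).Nonempty := by
  by_cases h6 : n < 6
  · interval_cases n
    · rw [fundBlock_eq_natForm 2 1 (by norm_num)]; decide
    · rw [fundBlock_eq_natForm 3 2 (by norm_num)]; decide
    · rw [fundBlock_eq_natForm 4 2 (by norm_num)]; decide
    · rw [fundBlock_eq_natForm 5 3 (by norm_num)]; decide
  push Not at h6
  obtain ⟨p, hp, hlt, hle⟩ := Nat.exists_prime_lt_and_le_two_mul (2 ^ (n - 4)) (by positivity)
  have hodd : p % 2 = 1 := by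
    rcases hp.eq_two_or_odd' with rfl | hodd
    · have : 4 ≤ 2 ^ (n - 4) := by
        calc (4:ℕ) = 2 ^ 2 := by norm_num
          _ ≤ 2 ^ (n - 4) := Nat.pow_le_pow_right Nat.two_pos (by omega)
      omega
    · exact Nat.odd_iff.1 hodd
  have hplt : p < 2 ^ (n - 3) := by
    have h2 : 2 * 2 ^ (n - 4) = 2 ^ (n - 3) := by
      rw [← pow_succ']; congr 1; omega
    rcases Nat.lt_or_eq_of_le hle with h | h
    · omega
    · exfalso
      have : 2 ∣ p := by rw [h]; exact dvd_mul_right 2 _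
      omega
  have hlo : 2 ^ (n - 1) = 8 * 2 ^ (n - 4) := by
    rw [show n - 1 = 3 + (n - 4) by omega, pow_add]; norm_num
  have hhi : 2 ^ n = 8 * 2 ^ (n - 3) := by
    rw [show n = 3 + (n - 3) by omega, pow_add]; norm_num
  refine ⟨8 * p, Finset.mem_filter.2 ⟨?_, Or.inr ⟨⟨-(2 * (p:ℤ)), by push_cast; ring⟩, ?_, ?_⟩⟩⟩
  · rw [Finset.mem_Ico]; omega
  · left; omega
  · rw [show (-((8 * p : ℕ) : ℤ)) / 4 = -((2 * p : ℕ) : ℤ) by omega, ← Int.squarefree_natAbs,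
      Int.natAbs_neg, Int.natAbs_natCast, Nat.squarefree_mul]
    · exact ⟨Nat.prime_two.squarefree, hp.squarefree⟩
    · exact (Nat.coprime_primes Nat.prime_two hp).2 (by omega)

/-! ### The sieve bound `3 · #fundBlock n ≤ 2^(n-1)` (`n ≥ 5`) -/

/-- Splitting a filtered count at `a`: `[a, b)` plus `[0, a)` is `[0, b)`. [folklore] -/
theorem card_filter_Ico_add_range (p : ℕ → Prop) [DecidablePred p] {a b : ℕ} (hab : a ≤ b) :
    #((Ico a b).filter p) + #((range a).filter p) = #((range b).filter p) := by
  rw [range_eq_Ico, range_eq_Ico, ← card_union_of_disjoint, ← filter_union, union_comm,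
    Ico_union_Ico_eq_Ico (Nat.zero_le a) hab]
  exact disjoint_filter_filter (Ico_disjoint_Ico_consecutive 0 a b).symm

/-- Exact count of an arithmetic progression in the dyadic block `[2^(n-1), 2^n)`
(`Nat.count_modEq_card` twice). [folklore] -/
theorem card_block_modEq (n : ℕ) {r : ℕ} (hr : 0 < r) (v : ℕ) :
    #((Ico (2 ^ (n - 1)) (2 ^ n)).filter (· ≡ v [MOD r])) +
      (2 ^ (n - 1) / r + if v % r < 2 ^ (n - 1) % r then 1 else 0)
      = 2 ^ n / r + if v % r < 2 ^ n % r then 1 else 0 := by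
  have h := card_filter_Ico_add_range (· ≡ v [MOD r])
    (Nat.pow_le_pow_right Nat.two_pos (Nat.sub_le n 1))
  rw [← Nat.count_eq_card_filter_range, ← Nat.count_eq_card_filter_range,
    Nat.count_modEq_card _ hr, Nat.count_modEq_card _ hr] at h
  exact h

/-- A squarefree number is not divisible by `9`. [folklore] -/
theorem not_nine_dvd_of_squarefree {m : ℕ} (h : Squarefree m) : ¬ 9 ∣ m := fun h9 => by
  have := Nat.isUnit_iff.1 (h 3 (by simpa using h9))
  omega

/-- A squarefree number is not divisible by `25`. [folklore] -/
theorem not_twentyfive_dvd_of_squarefree {m : ℕ} (h : Squarefree m) : ¬ 25 ∣ m := fun h25 => by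
  have := Nat.isUnit_iff.1 (h 5 (by simpa using h25))
  omega

/-- Residue/divisibility consequences of "`−d` fundamental". [folklore] -/
theorem isFundNeg_cases {d : ℕ} (h : IsFundNegL(d)) :
    (d % 4 = 3 ∧ ¬ 9 ∣ d ∧ ¬ 25 ∣ d) ∨ ((d % 16 = 4 ∨ d % 16 = 8) ∧ ¬ 9 ∣ d) := by
  rcases h with ⟨h1, h2, -⟩ | ⟨h4, h2, h3⟩
  · have hsq : Squarefree d := by
      rw [← Int.squarefree_natAbs, Int.natAbs_neg, Int.natAbs_natCast] at h2; exact h2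
    exact Or.inl ⟨by omega, not_nine_dvd_of_squarefree hsq, not_twentyfive_dvd_of_squarefree hsq⟩
  · right
    have hq : (-(d:ℤ)) / 4 = -((d / 4 : ℕ) : ℤ) := by omega
    have hsq : Squarefree (d / 4) := by
      rw [hq, ← Int.squarefree_natAbs, Int.natAbs_neg, Int.natAbs_natCast] at h3; exact h3
    refine ⟨by omega, fun h9 => not_nine_dvd_of_squarefree hsq ?_⟩
    omega

set_option maxHeartbeats 800000 in
/-- **Sieve bound, large levels**: for `n ≥ 11`, `3 · #fundBlock n ≤ 2^(n-1)`. The fundamental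
`d` lie in `{d ≡ 3 (4), 9 ∤ d, 25 ∤ d} ∪ {d ≡ 4, 8 (16), 9 ∤ d}`, of density
`(1/4)(1 − 1/9 − 1/25 + 1/225) + (1/8)(8/9) = 1168/3600 < 1/3`, and the eight arithmetic
progressions involved are counted exactly in the dyadic block (`card_block_modEq`), leaving
`omega` an `O(1)` slack that `2^(n-1) ≥ 1024` absorbs. (True density: `3/π² = 0.3040`.) [folklore] -/
theorem three_mul_card_fundBlock_le_of_large {n : ℕ} (hn : 11 ≤ n) :
    3 * #(fundBlockL(n)) ≤ 2 ^ (n - 1) := by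
  have h2N : 2 ^ n = 2 * 2 ^ (n - 1) := by
    rw [← pow_succ']; congr 1; omega
  have hNge : 1024 ≤ 2 ^ (n - 1) := by
    calc (1024 : ℕ) = 2 ^ 10 := by norm_num
      _ ≤ 2 ^ (n - 1) := Nat.pow_le_pow_right Nat.two_pos (by omega)
  set N := 2 ^ (n - 1) with hN
  set blk := Ico N (2 ^ n) with hblk
  set C1 := blk.filter (· ≡ 3 [MOD 4]) with hC1
  set A := blk.filter (· ≡ 27 [MOD 36]) with hA
  set B := blk.filter (· ≡ 75 [MOD 100]) with hB
  set AB := blk.filter (· ≡ 675 [MOD 900]) with hAB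
  set C2a := blk.filter (· ≡ 4 [MOD 16]) with hC2a
  set C2b := blk.filter (· ≡ 8 [MOD 16]) with hC2b
  set A2a := blk.filter (· ≡ 36 [MOD 144]) with hA2a
  set A2b := blk.filter (· ≡ 72 [MOD 144]) with hA2b
  have hsub : blk.filter (fun d : ℕ => IsFundNegL(d)) ⊆ (C1 \ (A ∪ B)) ∪ ((C2a \ A2a) ∪ (C2b \ A2b)) := by
    intro d hd
    rw [mem_filter] at hd
    obtain ⟨hdb, hf⟩ := hd
    simp only [hC1, hA, hB, hC2a, hC2b, hA2a, hA2b, mem_union, mem_sdiff, mem_filter, Nat.ModEq]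
    rcases isFundNeg_cases hf with ⟨h4, h9, h25⟩ | ⟨h16, h9⟩
    · left
      refine ⟨⟨hdb, by omega⟩, ?_⟩
      rintro (⟨-, h⟩ | ⟨-, h⟩) <;> omega
    · right
      rcases h16 with h16 | h16
      · left
        refine ⟨⟨hdb, by omega⟩, ?_⟩
        rintro ⟨-, h⟩; omega
      · right
        refine ⟨⟨hdb, by omega⟩, ?_⟩
        rintro ⟨-, h⟩; omega
  have hABsub : A ∩ B ⊆ AB := by
    intro d hd
    simp only [hA, hB, hAB, mem_inter, mem_filter, Nat.ModEq] at hd ⊢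
    exact ⟨hd.1.1, by omega⟩
  have hAsub : A ∪ B ⊆ C1 := by
    intro d hd
    simp only [hA, hB, hC1, mem_union, mem_filter, Nat.ModEq] at hd ⊢
    rcases hd with hd | hd
    · exact ⟨hd.1, by omega⟩
    · exact ⟨hd.1, by omega⟩
  have hA2asub : A2a ⊆ C2a := by
    intro d hd
    simp only [hA2a, hC2a, mem_filter, Nat.ModEq] at hd ⊢
    exact ⟨hd.1, by omega⟩
  have hA2bsub : A2b ⊆ C2b := by
    intro d hd
    simp only [hA2b, hC2b, mem_filter, Nat.ModEq] at hd ⊢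
    exact ⟨hd.1, by omega⟩
  have eC1 := card_block_modEq n (r := 4) (by norm_num) 3
  have eA := card_block_modEq n (r := 36) (by norm_num) 27
  have eB := card_block_modEq n (r := 100) (by norm_num) 75
  have eAB := card_block_modEq n (r := 900) (by norm_num) 675
  have eC2a := card_block_modEq n (r := 16) (by norm_num) 4
  have eC2b := card_block_modEq n (r := 16) (by norm_num) 8
  have eA2a := card_block_modEq n (r := 144) (by norm_num) 36
  have eA2b := card_block_modEq n (r := 144) (by norm_num) 72
  rw [← hN, ← hblk] at eC1 eA eB eAB eC2a eC2b eA2a eA2b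
  rw [← hC1] at eC1; rw [← hA] at eA; rw [← hB] at eB; rw [← hAB] at eAB
  rw [← hC2a] at eC2a; rw [← hC2b] at eC2b; rw [← hA2a] at eA2a; rw [← hA2b] at eA2b
  have k0 := card_le_card hsub
  have k1 := card_union_le (C1 \ (A ∪ B)) ((C2a \ A2a) ∪ (C2b \ A2b))
  have k2 := card_union_le (C2a \ A2a) (C2b \ A2b)
  have k3 := card_sdiff_of_subset hAsub
  have k4 := card_union_add_card_inter A B
  have k5 := card_le_card hABsub
  have k6 := card_sdiff_of_subset hA2asub
  have k7 := card_sdiff_of_subset hA2bsub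
  have k8 := card_le_card hAsub
  have k9 := card_le_card hA2asub
  have k10 := card_le_card hA2bsub
  have hN16 : N = 16 * 2 ^ (n - 5) := by
    rw [hN, show n - 1 = 4 + (n - 5) by omega, pow_add]; norm_num
  rw [h2N] at eC1 eA eB eAB eC2a eC2b eA2a eA2b
  have bC1 : #C1 = N / 4 := by split_ifs at eC1 <;> omega
  have bA : N / 36 ≤ #A := by split_ifs at eA <;> omega
  have bB : N / 100 ≤ #B := by split_ifs at eB <;> omega
  have bAB : #AB ≤ N / 900 + 1 := by split_ifs at eAB <;> omega
  have bC2a : #C2a = N / 16 := by split_ifs at eC2a <;> omega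
  have bC2b : #C2b = N / 16 := by split_ifs at eC2b <;> omega
  have bA2a : N / 144 ≤ #A2a := by split_ifs at eA2a <;> omega
  have bA2b : N / 144 ≤ #A2b := by split_ifs at eA2b <;> omega
  clear eC1 eA eB eAB eC2a eC2b eA2a eA2b
  omega

/-- **At most a third of the n-bit integers are (negated) fundamental discriminants**, for every
`n ≥ 5` (`decide` for `5 ≤ n ≤ 10`, the sieve above from `11` on). Sharp in the sense that the
blocks `n = 5, 6, 7` have exactly `5/16, 10/32, 20/64 = 0.3125` and `n ≤ 4` exceed `1/3`. [folklore] -/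
theorem three_mul_card_fundBlock_le {n : ℕ} (hn : 5 ≤ n) :
    3 * #(fundBlockL(n)) ≤ 2 ^ (n - 1) := by
  by_cases h11 : 11 ≤ n
  · exact three_mul_card_fundBlock_le_of_large h11
  interval_cases n
  · rw [fundBlock_eq_natForm 5 3 (by norm_num)]; decide
  · rw [fundBlock_eq_natForm 6 3 (by norm_num)]; decide
  · rw [fundBlock_eq_natForm 7 4 (by norm_num)]; decide
  · rw [fundBlock_eq_natForm 8 4 (by norm_num)]; decide +kernel
  · rw [fundBlock_eq_natForm 9 5 (by norm_num)]; decide +kernel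
  · rw [fundBlock_eq_natForm 10 5 (by norm_num)]; decide +kernel


end Summit.QuantumAdvantage.QuantumAdvantage.Theorems.AvgFaceBeyondPrior.Negative.Blocks
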